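import Summits.CriticalPhenomena.PercolationContinuityZ3.Theorems.PercNearOneGluingNoHeavyQuantFarLayerOneTreeObserver
import Summits.CriticalPhenomena.PercolationContinuityZ3.Theorems.PercNearOneGluingNoHeavyQuantFarLayerOneUnicyclic
import Summits.CriticalPhenomena.PercolationContinuityZ3.Theorems.PercNearOneGluingNoHeavyQuantFarSeparation
import HarnessLib

/-!
# QUANT lane R8, front "FAR beyond trees" — a TREE observer with ALL relays below it: layer one by restriction and a phantom cycle

builds on p205010 (kernel theorem, internal audit signed; external expert review pending)

Support file (`--supports stmt-CriticalPhenomena-4575`), seat `prim-quant-p1` (gen 18); memo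
`run/shared/lean/prim/quant/prim-quant-p1-g18/FOR-PROVERS-FLATTENING-FC.md` §1 (wrapper R4).  One definition (`fake3`); standard axioms; no sorries.

If the observer `o` is a tree vertex of a pendant forest on a cycle and EVERY relay lies below `o` (`Bundle.Below`), the relay events only see the pairs
inside `S ∪ {o}` (`S` = the vertices below `o`; separation `Bundle.below_sep` + `Quant.openConn_iff_openConnIn_of_sep`), so the weight function may be
switched off outside (`TwoGate.measureReal_preimage_off`); the restricted weight function is a pendant forest on a PHANTOM triangle `(o, c_0, c_1)` with
zero-weight cycle pairs, to which `Bundle.farp_one_of_pforest` applies with observer `o`: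
* `Quant.Bundle.real_relayEvent_eq_restrict` — the law identity for the events `{N_o ≤ 1}` and `{o ↔ a}`;
* `Quant.Bundle.pforest_phantom` — the phantom presentation;
* **`Quant.Bundle.layerOne_of_pforest_treeObs_allBelow`** — layer one at `o` given `SunFAR |A| 1`.
[cite: KozmaNitzan2024, Conjecture 3 (p. 15)]; [cite: Grimmett1999, §1.3 p. 10; §2.2]; [this work].
-/

noncomputable section

namespace Summit.CriticalPhenomena.PercolationContinuityZ3.Theorems

namespace Quant

namespace Bundle

open Finset MeasureTheory Set
open Literature.Probability.LatticeModels
open Literature.Probability.Percolation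
open Summit.CriticalPhenomena.PercolationContinuityZ3.Theorems.HairyCycle (cycE SunFAR)
open CutObserver
open scoped Classical

variable {n : ℕ}

/-- The phantom triangle `(o, x, y)` as a cycle map. [this work] -/
def fake3 (o x y : Fin n) (i : ℕ) : Fin n := if i = 0 then o else if i = 1 then x else y

section AllBelow

variable {L : ℕ} {cyc : ℕ → Fin n} {idx : Fin n → ℕ} {T : Finset (Fin n)} {par : Fin n → Fin n} {dep : Fin n → ℕ}
  {w : Sym2 (Fin n) → unitInterval} (P : PForest L cyc idx T par dep w) {o : Fin n} (hoT : o ∈ T)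
include P hoT

/-- **The law identity**: for relays all below `o`, the light event and the marginals at `o` have the same probability under `w` and under `w` switched
off outside the pairs inside `S ∪ {o}`. [this work] -/
theorem real_relayEvent_eq_restrict (A : Finset (Fin n)) (hA : ∀ a ∈ A, Below T par o a) (Q : Finset (Fin n) → Prop) :
    (prodBernoulli w).real {ω : BondConfig (Fin n) | Q (A.filter fun a => ω ∈ openConn o a)} =
      (prodBernoulli fun e : Sym2 (Fin n) => if (∀ z ∈ e, z = o ∨ Below T par o z) then w e else 0).real
        {ω : BondConfig (Fin n) | Q (A.filter fun a => ω ∈ openConn o a)} := by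
  set D : Set (Sym2 (Fin n)) := {e | ∀ z ∈ e, z = o ∨ Below T par o z} with hD
  set w' : Sym2 (Fin n) → unitInterval := fun e => if e ∈ D then w e else 0 with hw'
  set S : Set (Fin n) := {x | Below T par o x} with hS
  have hoS : o ∉ S := not_below_self P hoT
  have hsep : ∀ u v : Fin n, u ∈ S → v ∉ S → v ≠ o → w s(u, v) = 0 := below_sep P
  have hsep' : ∀ u v : Fin n, u ∈ S → v ∉ S → v ≠ o → w' s(u, v) = 0 := by
    intro u v hu hv hvo
    have : s(u, v) ∉ D := by
      intro h
      rcases h v (Sym2.mem_mk_right u v) with h' | h'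
      · exact hvo h'
      · exact hv h'
    show (if s(u, v) ∈ D then w s(u, v) else 0) = 0
    rw [if_neg this]
  -- the INSIDE event
  set Ein : Set (BondConfig (Fin n)) := {ω | Q (A.filter fun a => ω ∈ openConnIn (insert o S) o a)} with hEin
  have hdetEin : DeterminedBy Ein {e | ∀ z ∈ e, z ∈ insert o S} := by
    rw [determinedBy_iff]
    intro ω ω' h
    have hfil : (A.filter fun a => ω ∈ openConnIn (insert o S) o a) = (A.filter fun a => ω' ∈ openConnIn (insert o S) o a) := by
      refine filter_congr fun a _ => ?_
      have hdet := determinedBy_openConnIn_of_pairs (insert o S) o a (K := {e : Sym2 (Fin n) | ∀ z ∈ e, z ∈ insert o S})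
        (fun u v hu hv _ => fun z hz => by rcases Sym2.mem_iff.1 hz with rfl | rfl <;> assumption)
      exact (determinedBy_iff _ _).1 hdet ω ω' h
    simp only [hEin, mem_setOf_eq, hfil]
  -- (1) under any weight function `u` with the separation property, the event equals the inside event almost surely
  have key : ∀ u : Sym2 (Fin n) → unitInterval, (∀ x y : Fin n, x ∈ S → y ∉ S → y ≠ o → u s(x, y) = 0) →
      (prodBernoulli u).real {ω : BondConfig (Fin n) | Q (A.filter fun a => ω ∈ openConn o a)} = (prodBernoulli u).real Ein := by
    intro u husep
    rw [PendantPeeling.measureReal_eq_inter_support u {ω : BondConfig (Fin n) | Q (A.filter fun a => ω ∈ openConn o a)},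
      PendantPeeling.measureReal_eq_inter_support u Ein]
    congr 1
    ext ω
    simp only [mem_setOf_eq, hEin]
    have hω : ∀ e ∈ ω ∩ {e | u e ≠ 0}, u e ≠ 0 := fun e he => he.2
    have hfil : (A.filter fun a => ω ∩ {e | u e ≠ 0} ∈ openConn o a) =
        (A.filter fun a => ω ∩ {e | u e ≠ 0} ∈ openConnIn (insert o S) o a) :=
      filter_congr fun a ha => Quant.openConn_iff_openConnIn_of_sep u S o hoS husep hω (hA a ha)
    rw [hfil]
  -- (2) the inside event has the same probability under `w` and `w'`
  have hmid : (prodBernoulli w).real Ein = (prodBernoulli w').real Ein := by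
    refine prodBernoulli_real_eq_of_determinedBy w w' (F := {e : Sym2 (Fin n) | ∀ z ∈ e, z ∈ insert o S}) ?_ hdetEin
      (Set.toFinite _).measurableSet
    intro e he
    have heD : e ∈ D := fun z hz => by
      rcases Set.mem_insert_iff.1 (he z hz) with h | h
      · exact Or.inl h
      · exact Or.inr h
    show w e = (if e ∈ D then w e else 0)
    rw [if_pos heD]
  rw [key w hsep, hmid, ← key w' hsep']
  rfl

/-- **The phantom presentation**: with all pairs outside `S ∪ {o}` switched off, the forest below `o` is a pendant forest on the phantom triangle
`(o, c_0, c_1)` (zero-weight cycle pairs), `o = fake3 o c_0 c_1 0`. [this work] -/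
theorem pforest_phantom :
    PForest 3 (fake3 o (cyc 0) (cyc 1)) (fun v => if v = o then 0 else if v = cyc 0 then 1 else 2) (T.filter fun v => Below T par o v) par dep
      (fun e : Sym2 (Fin n) => if (∀ z ∈ e, z = o ∨ Below T par o z) then w e else 0) := by
  have hL0 : 0 < L := by have := P.hL; omega
  have hL1 : 1 < L := by have := P.hL; omega
  have hc0 : cyc 0 ∉ T := P.cyc_notMem 0 hL0
  have hc1 : cyc 1 ∉ T := P.cyc_notMem 1 hL1
  have ho0 : o ≠ cyc 0 := fun h => hc0 (h ▸ hoT)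
  have ho1 : o ≠ cyc 1 := fun h => hc1 (h ▸ hoT)
  have h01 : cyc 0 ≠ cyc 1 := fun h => by have := P.hcyc 0 1 hL0 hL1 h; omega
  have hf0 : fake3 o (cyc 0) (cyc 1) 0 = o := by simp [fake3]
  have hf1 : fake3 o (cyc 0) (cyc 1) 1 = cyc 0 := by simp [fake3]
  have hf2 : fake3 o (cyc 0) (cyc 1) 2 = cyc 1 := by simp [fake3]
  have hval : ∀ i, i < 3 → fake3 o (cyc 0) (cyc 1) i = o ∧ i = 0 ∨ fake3 o (cyc 0) (cyc 1) i = cyc 0 ∧ i = 1 ∨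
      fake3 o (cyc 0) (cyc 1) i = cyc 1 ∧ i = 2 := by
    intro i hi
    interval_cases i
    · exact Or.inl ⟨hf0, rfl⟩
    · exact Or.inr (Or.inl ⟨hf1, rfl⟩)
    · exact Or.inr (Or.inr ⟨hf2, rfl⟩)
  refine ⟨le_rfl, ?_, ?_, ?_, ?_, ?_, ?_⟩
  · -- injective
    intro i j hi hj h
    rcases hval i hi with ⟨ei, rfl⟩ | ⟨ei, rfl⟩ | ⟨ei, rfl⟩ <;> rcases hval j hj with ⟨ej, rfl⟩ | ⟨ej, rfl⟩ | ⟨ej, rfl⟩ <;>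
      first | rfl | (exfalso; rw [ei] at h; rw [ej] at h; first | exact ho0 h | exact ho1 h | exact h01 h | exact ho0 h.symm | exact ho1 h.symm | exact h01 h.symm)
  · -- index map
    intro i hi
    rcases hval i hi with ⟨ei, rfl⟩ | ⟨ei, rfl⟩ | ⟨ei, rfl⟩
    · rw [ei]; simp
    · rw [ei]; simp [ho0.symm]
    · rw [ei]; simp [ho1.symm, h01.symm]
  · -- phantom cycle vertices are not in the restricted forest
    intro i hi h
    have hT := (mem_filter.1 h)
    rcases hval i hi with ⟨ei, rfl⟩ | ⟨ei, rfl⟩ | ⟨ei, rfl⟩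
    · rw [ei] at hT; exact not_below_self P hoT hT.2
    · rw [ei] at hT; exact hc0 hT.1
    · rw [ei] at hT; exact hc1 hT.1
  · -- parents: below `o` or equal to `o = fake 0`
    intro v hv
    obtain ⟨hvT, hvb⟩ := mem_filter.1 hv
    rcases below_par_or_eq hvb with h | h
    · exact Or.inl (mem_filter.2 ⟨h.mem, h⟩)
    · exact Or.inr ⟨0, by omega, by rw [hf0]; exact h⟩
  · -- ranking
    intro v hv hp
    exact P.dep_lt v (mem_filter.1 hv).1 (mem_filter.1 hp).1
  · -- support: a positive pair of the restricted weights is inside `S ∪ {o}` and positive for `w`, hence a tree pair below `o`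
    intro x y hxy hw
    have hD : ∀ z ∈ s(x, y), z = o ∨ Below T par o z := by
      by_contra h; rw [if_neg h] at hw; exact hw rfl
    have hw0 : w s(x, y) ≠ 0 := by rw [if_pos hD] at hw; exact hw
    have hx := hD x (Sym2.mem_mk_left x y)
    have hy := hD y (Sym2.mem_mk_right x y)
    -- not `o – par o`: `par o` is neither `o` nor below `o`
    have hparo : ¬ (par o = o ∨ Below T par o (par o)) := by
      rintro (h | h)
      · exact P.par_ne hoT h
      · exact not_below_self P hoT (below_of_par_below hoT rfl h)
    rcases P.supp x y hxy hw0 with ⟨i, hi, he⟩ | ⟨hxT, h⟩ | ⟨hyT, h⟩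
    · exfalso
      -- a real cycle pair has endpoints off `T`, but `x` is `o` or below `o`, both in `T`
      have hxT : x ∈ T := by rcases hx with rfl | hx; exact hoT; exact hx.mem
      exact P.not_mem_cycE hxT hi (he ▸ Sym2.mem_mk_left x y)
    · right; left
      refine ⟨mem_filter.2 ⟨hxT, ?_⟩, h⟩
      rcases hx with rfl | hx
      · exact absurd (h ▸ hy) hparo
      · exact hx
    · right; right
      refine ⟨mem_filter.2 ⟨hyT, ?_⟩, h⟩
      rcases hy with rfl | hy
      · exact absurd (h ▸ hx) hparo
      · exact hy

/-- **Layer one for a TREE observer with ALL relays below it**, given `SunFAR |A| 1`: `2 < Σ_{a∈A} P(o ↔ a)` and `P(o ↮ a) ≤ t` on `A` imply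
`P(N_o ≤ 1) ≤ t`. [this work] -/
theorem layerOne_of_pforest_treeObs_allBelow (A : Finset (Fin n)) (hA : ∀ a ∈ A, Below T par o a) (hS : SunFAR A.card 1) (t : ℝ)
    (hEN : (2 : ℝ) < ∑ a ∈ A, (prodBernoulli w).real (openConn o a))
    (hcut : ∀ a ∈ A, (prodBernoulli w).real (openConn o a : Set (BondConfig (Fin n)))ᶜ ≤ t) :
    (prodBernoulli w).real {ω : BondConfig (Fin n) | (A.filter fun a => ω ∈ openConn o a).card ≤ 1} ≤ t := by
  have hmeas : ∀ U : Set (BondConfig (Fin n)), MeasurableSet U := fun U => (Set.toFinite U).measurableSet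
  set w' : Sym2 (Fin n) → unitInterval := fun e : Sym2 (Fin n) => if (∀ z ∈ e, z = o ∨ Below T par o z) then w e else 0 with hw'
  have P' := pforest_phantom P hoT
  -- marginals agree
  have hmarg : ∀ a ∈ A, (prodBernoulli w').real (openConn o a) = (prodBernoulli w).real (openConn o a) := by
    intro a ha
    have h := real_relayEvent_eq_restrict P hoT {a} (fun b hb => by rw [Finset.mem_singleton.1 hb]; exact hA a ha) (fun F => a ∈ F)
    have hset : {ω : BondConfig (Fin n) | a ∈ ({a} : Finset (Fin n)).filter fun b => ω ∈ openConn o b} = openConn o a := by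
      ext ω; simp
    rw [hset] at h
    exact h.symm
  have hlight := real_relayEvent_eq_restrict P hoT A hA (fun F => F.card ≤ 1)
  rw [hlight]
  have hoA : fake3 o (cyc 0) (cyc 1) 0 ∉ A := by
    simp only [fake3, if_true]
    intro h; exact not_below_self P hoT (hA o h)
  have hA' : ∀ a ∈ A, a ∈ (T.filter fun v => Below T par o v) ∨ ∃ i, i < 3 ∧ a = fake3 o (cyc 0) (cyc 1) i :=
    fun a ha => Or.inl (mem_filter.2 ⟨(hA a ha).mem, hA a ha⟩)
  have key := farp_one_of_pforest A hS _ _ par dep w' P' le_rfl hA' hoA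
  have hf0 : fake3 o (cyc 0) (cyc 1) 0 = o := by simp [fake3]
  rw [hf0] at key
  refine key ?_ t ?_
  · rw [Finset.sum_congr rfl hmarg]; push_cast; linarith
  · intro a ha
    rw [probReal_compl_eq_one_sub (hmeas _), hmarg a ha, ← probReal_compl_eq_one_sub (hmeas _)]
    exact hcut a ha

end AllBelow

end Bundle

end Quant

end Summit.CriticalPhenomena.PercolationContinuityZ3.Theorems
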